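import Literature.Probability.RandomPlanarGeometry.SAWKestenTransfer
import Literature.Probability.RandomPlanarGeometry.SAWKestenCylStraight
import HarnessLib

/-!
# The crux IRR-PREFIX needs `a ≥ 0` and, at `a = 0`, `C ≥ μ` (lane «pcv-sawmu», route R45 «INF-BRIDGE», negative side)

Topic `Literature/Probability/RandomPlanarGeometry` (continues `SAWKestenTransfer.lean`: the lane's open hypothesis
`Zd.IrrPrefixPoly C a` = "`P^B_∞(ζ[0,m] = q) ≤ C m^a μ^{-m}` for all `m ≥ 1`, `q ∈ S_m(ℤ²)`", and `SAWKestenCylStraight.lean`: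
`P^B_∞(ζ[0,m] = E^m) ≥ μ^{1-m}`).

Source of the objects: N. Madras, G. Slade, *The Self-Avoiding Walk* (1993), §8.3 (Kesten's measure). The two statements are the
lane's refute-first census of route R45 made kernel facts (a-ref-1 g17: "IrrPrefixPoly C a is FALSE for every a < 0 and for every
C < μ — witness q = E^m"): `not_irrPrefixPoly_zero_of_lt` (`C < μ ⇒ ¬ IrrPrefixPoly C 0`, from `m = 1`) and
`not_irrPrefixPoly_of_neg` (`a < 0 ⇒ ¬ IrrPrefixPoly C a`, from `μ ≤ C m^a` for all `m ≥ 1`).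
Tree-twin search: stems `not_irrPrefixPoly`, `IrrPrefixPoly.*false` → none. No twin.
-/

noncomputable section

open Filter Topology Literature.Probability.LatticeModels Literature.Probability.Percolation

namespace Literature.Probability.RandomPlanarGeometry.SAW.Zd

/-- Under `IrrPrefixPoly C a`, `μ ≤ C m^a` for every `m ≥ 1` (test the hypothesis on the straight prefix `E^m`).
[cite: MadrasSlade1993, §8.3, Theorem 8.3.1 and eq. (8.3.6) (quantitative consequence, this file)] -/
theorem connectiveConstant_le_of_irrPrefixPoly {C a : ℝ} (h : IrrPrefixPoly C a) {m : ℕ} (hm : 1 ≤ m) :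
    connectiveConstant 2 ≤ C * (m : ℝ) ^ a := by
  have hμ := connectiveConstant_pos 2
  have h1 := kestenCyl_straightWalk_ge (d := 2) hm
  have h2 := h m hm (straightWalk 2 m) (straightWalk_mem_saws 2 m)
  have h3 : connectiveConstant 2 / connectiveConstant 2 ^ m ≤ C * (m : ℝ) ^ a * (connectiveConstant 2 ^ m)⁻¹ := h1.trans h2
  rw [← div_eq_mul_inv, div_le_div_iff_of_pos_right (pow_pos hμ m)] at h3
  exact h3

/-- **`IrrPrefixPoly C 0` is false for `C < μ`** (`m = 1`: the first step of Kesten's bridge is `+e₀` with probability `1`).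
[cite: MadrasSlade1993, §8.3, Theorem 8.3.1 (quantitative consequence, this file)] -/
theorem not_irrPrefixPoly_zero_of_lt {C : ℝ} (hC : C < connectiveConstant 2) : ¬ IrrPrefixPoly C 0 := by
  intro h
  have := connectiveConstant_le_of_irrPrefixPoly h le_rfl
  simp only [Nat.cast_one, Real.rpow_zero, mul_one] at this
  linarith

/-- **`IrrPrefixPoly C a` is false for `a < 0`** (`μ ≤ C m^a → 0`).
[cite: MadrasSlade1993, §8.3, Theorem 8.3.1 (quantitative consequence, this file)] -/
theorem not_irrPrefixPoly_of_neg {C a : ℝ} (ha : a < 0) : ¬ IrrPrefixPoly C a := by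
  intro h
  have hμ := connectiveConstant_pos 2
  -- `C m^a → 0` along `m → ∞`, contradicting `μ ≤ C m^a`
  have hlim : Tendsto (fun m : ℕ => C * ((m : ℝ) + 1) ^ a) atTop (𝓝 (C * 0)) := by
    have h1 : Tendsto (fun x : ℝ => x ^ a) atTop (𝓝 0) := by
      have := tendsto_rpow_neg_atTop (show 0 < -a by linarith)
      simpa using this
    have h2 : Tendsto (fun m : ℕ => (m : ℝ) + 1) atTop atTop :=
      tendsto_atTop_add_const_right _ 1 tendsto_natCast_atTop_atTop
    exact (h1.comp h2).const_mul C
  rw [mul_zero] at hlim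
  have hev := (hlim.eventually (gt_mem_nhds hμ)).exists
  obtain ⟨m, hm⟩ := hev
  have := connectiveConstant_le_of_irrPrefixPoly h (show 1 ≤ m + 1 by omega)
  push_cast at this
  linarith

end Literature.Probability.RandomPlanarGeometry.SAW.Zd

end
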